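import Summits.CriticalPhenomena.PercolationContinuityZ3.Theorems.PercNearOneGluingNoHeavyPcintNawMemZ4M10Defs1
import Summits.CriticalPhenomena.PercolationContinuityZ3.Theorems.PercNearOneGluingNoHeavyPcintNawMemZ4M10Defs2
import Summits.CriticalPhenomena.PercolationContinuityZ3.Theorems.PercNearOneGluingNoHeavyPcintNawRandMemKernelSymTab
import HarnessLib

/-!
# PCINT lane, kernel reduced-state B2r certificate `Z4M10` (d = 4, memory τ = 10, 729 state classes): table root, symmetry table, parameters

Cell `prim-pcint`, seat `prim-pcint-1` (gen 5); memo `run/shared/lean/prim/pcint/INTERVAL-PLAN.md` §16 ("checker for the reduced-state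
automata").  Does NOT build on p205010.  Data for `NawK.le_siteCriticalProb_of_checkRows` (`…PcintNawRandMemKernelCert`): `p = 16820/100000`,
`q̄ = 97404/100000` (`q̄^7·100000^7 ≥ (100000-16820)·100000^6`), `κ̄ = (100000+97404)/(2·100000)`, `λ = 99999/100000`; Collatz–Wielandt weights (scale 10⁹) from a
power iteration, exact off-line max row ratio 0.9997594500 < λ.  Generated by gen5/gen_lean.py (pcint-1 folder); the kernel re-checks every row.
-/

noncomputable section

namespace Summit.CriticalPhenomena.PercolationContinuityZ3.Theorems.Pcint

namespace NawMemZ4M10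

set_option maxRecDepth 8000 in
/-- The certificate table (search tree keyed by row index). [folklore] -/
def tree : NawK.NT := (NawK.NT.node t_0_364 364 (416309191, [([-1,-1,-1,0], 3), ([-1,-1,0,0], 2), ([-1,0,0,0], 1), ([0,-1,-1,-1], 5), ([0,-1,-1,0], 4), ([1,-1,-1,-1], 6), ([1,-1,0,-1], 7)], [some (606, 0), none, some (229, 2), none, some (230, 4), none, some (231, 6), some (607, 7)]) t_365_729)

/-- The 8 signed permutations of `ℤ^4` used by the certificate, as tables. [folklore] -/
def syms : List (List (ℕ × Bool)) := [[(0, true), (1, true), (2, true), (3, true)], [(0, false), (1, true), (2, true), (3, true)], [(1, true), (0, true), (2, true), (3, true)], [(1, true), (0, false), (2, true), (3, true)], [(1, true), (2, true), (0, true), (3, true)], [(1, true), (2, true), (0, false), (3, true)], [(1, true), (2, true), (3, true), (0, true)], [(1, true), (2, true), (3, true), (0, false)]]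

/-- Every table is a valid signed permutation table. [folklore] -/
theorem syms_valid : syms.all (NawK.validTab 4) = true := by decide +kernel

/-- The row check of this certificate. [folklore] -/
def chk (i : ℕ) : Bool := NawK.checkRow 10 4 729 16820 97404 100000 99999 100000 syms tree i

end NawMemZ4M10

end Summit.CriticalPhenomena.PercolationContinuityZ3.Theorems.Pcint
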